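import Summits.ValiantsHypothesis.ValiantsHypothesis.Theorems.LacunarySymmetroidMatrixDescartesCensusTwistedRolle
import Summits.ValiantsHypothesis.ValiantsHypothesis.Theorems.LacunarySymmetroidMatrixDescartesCensusDoorA34SquareLawSeparated

/-!
# `MatrixDescartes` census — DOOR A at `(3,4)`, flag ladder one size down: the `(2,3)` DEFINITE-END-LETTER LAW, part 1 (calculus core) —
# the top-branch defect of a `2 × 2` three-letter pencil has at most FOUR positive zeros when `d₂ > 2d₁`

HONEST FRAMING.  Object-search cell `pub-symmetroid`, door-A seat `val-sym-door-p3` (g24); helper file `--supports` the OPEN typed statement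
`Theses.LacunarySymmetroid.DoorA34 = PosRootLawAt 3 4 18` (stmt-ValiantsHypothesis-19980), asserted nowhere here.  WHY IT IS HERE.  The cell's one
mechanism of record with ceiling `19` at `(3,4)` is the FLAG LADDER over a `(3,3)` source nine-row; the kernel (`Census.flagLaw_no_five_one`,
`Census.FlagInertia.flag_inertia_law`, `Census.NineInertia.chamberII_unique_psdSingular_of_posDef`) reduces it to a definite-end-letter `(3,3)` row ALL
of whose roots are positive-semidefinite singular points («Claim L»: none exists; closed on `d₂ > 2d₁`, OPEN on `d₂ < 2d₁`).  This file and its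
companion `…DefiniteEndLetterTwo` put into the kernel the `m = 2` TEMPLATE of that statement with its genuinely MAGNITUDE-LEVEL proof (seat report
DOOR-A34-P3G7 §2b, 2026-08-27, «paper, new» there): for `F(x) = 1 + x^{a}S₁ + x^{a+n}S₂` (`S₁, S₂` real symmetric `2 × 2`, `0 < a < n`, i.e.
`d₂ > 2d₁`) the TOP eigenvalue branch is crossed at most `4 < 5 = D(2,3)` times.  Writing `G(x) = −(S₁ + xⁿS₂)`, `T = tr G = T₀ + T₁xⁿ`,
`Q = (tr G)² − 4 det G = A x^{2n} + B xⁿ + C₀` (a sum of two squares: `A, C₀ ≥ 0`, `B² ≤ 4AC₀`), a PSD-singular point of `F` is a zero of the DEFECT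
`ρ(x) = T₀ + T₁xⁿ + √Q(x) − 2/xᵃ`.  THIS FILE (pure real analysis, no matrices):

* `hasDerivAt_rho`, `rho'_eq_pow_mul_psi`, `hasDerivAt_psi` — `ρ′ = x^{n−1}·ψ` with `ψ = nT₁ + n(2Axⁿ + B)/(2√Q) + 2a/x^{a+n}` (the Euler
  twist killing the affine part `T₀ + T₁xⁿ`), and the CLOSED FORM `ψ′ = −(n²Δ/4)·x^{n−1}/(Q√Q) − 2a(a+n)/x^{a+n+1}`, `Δ = B² − 4AC₀ ≤ 0` — the
  `2 × 2` miracle `(√Q)″ ∝ −Δ·Q^{−3/2}`;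
* `critical_eq_of_psi'_eq_zero` — a zero of `ψ′` solves `n⁴Δ²·z^{2a+4n} = 64a²(a+n)²·Q(z)³`; `critical_eq_three_false` — along `z = w³` this is
  the fewnomial `A w^{6n} − κ w^{2a+4n} + B w^{3n} + C₀ = 0` (`κ` a real cube root), which has at most TWO positive roots
  (`card_posRoots_criticalFewnomial_le_two`: one Euler twist at `3n`, `Census.card_posRoots_le_card_posRoots_twists`, leaves a trinomial with signs
  `(≤0, ·, ≥0)` because `6n > 2a + 4n` EXACTLY WHEN `n > a`, `SquareLaw.card_posRoots_le_one_of_nonpos_nonneg'`);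
* **`rho_five_zeros_false`** — Rolle twice (Mathlib `exists_hasDerivAt_eq_zero`): if `Q > 0` on `(0,∞)` then `ρ` has no five zeros
  `0 < x₀ < ⋯ < x₄`.

Nothing here bounds `ζ_sym(3,3)` or `ζ_sym(3,4)`; `DoorA34`, Claim L on `d₂ < 2d₁` and `MatrixDescartes` (stmt-ValiantsHypothesis-18050) stay OPEN;
nothing on `VP ≠ VNP`.  [folklore] Rolle's theorem, Descartes' rule for fewnomials (Euler twists); the argument is the seat lineage's (DOOR-A34-P3G7 §2b),
no published source.
-/

set_option linter.dupNamespace false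

namespace Summit.ValiantsHypothesis.ValiantsHypothesis.Theorems.LacunarySymmetroidMatrixDescartes.Census

namespace EndLetterTwo

open Polynomial Finset Set
open scoped BigOperators Polynomial

/-! ## 1. Calculus of the top-branch defect `ρ(x) = T₀ + T₁xⁿ + √Q(x) − 2/xᵃ` -/

/-- Derivative of `Q(x) = A x^{2n} + B xⁿ + C₀`. [folklore] -/
theorem hasDerivAt_Q (A B C₀ : ℝ) (n : ℕ) (y : ℝ) :
    HasDerivAt (fun x : ℝ => A * x ^ (2 * n) + B * x ^ n + C₀)
      (A * ((2 * n : ℕ) * y ^ (2 * n - 1)) + B * ((n : ℕ) * y ^ (n - 1))) y := by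
  have h1 := (hasDerivAt_pow (2 * n) y).const_mul A
  have h2 := (hasDerivAt_pow n y).const_mul B
  have h3 := (h1.fun_add h2).fun_add (hasDerivAt_const y C₀)
  simpa using h3

/-- Derivative of the defect `ρ`. [folklore] -/
theorem hasDerivAt_rho (A B C₀ T₀ T₁ : ℝ) (a n : ℕ) {y : ℝ} (hy : 0 < y)
    (hQ : 0 < A * y ^ (2 * n) + B * y ^ n + C₀) :
    HasDerivAt (fun x : ℝ => T₀ + T₁ * x ^ n + Real.sqrt (A * x ^ (2 * n) + B * x ^ n + C₀) - 2 * (x ^ a)⁻¹)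
      (T₁ * ((n : ℕ) * y ^ (n - 1))
        + (A * ((2 * n : ℕ) * y ^ (2 * n - 1)) + B * ((n : ℕ) * y ^ (n - 1)))
            / (2 * Real.sqrt (A * y ^ (2 * n) + B * y ^ n + C₀))
        - 2 * (-((a : ℕ) * y ^ (a - 1)) / (y ^ a) ^ 2)) y := by
  have h1 : HasDerivAt (fun x : ℝ => T₀ + T₁ * x ^ n) (T₁ * ((n : ℕ) * y ^ (n - 1))) y := by
    simpa using ((hasDerivAt_pow n y).const_mul T₁).const_add T₀
  have h2 := (hasDerivAt_Q A B C₀ n y).sqrt hQ.ne'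
  have h3 : HasDerivAt (fun x : ℝ => (x ^ a)⁻¹) (-((a : ℕ) * y ^ (a - 1)) / (y ^ a) ^ 2) y :=
    (hasDerivAt_pow a y).fun_inv (pow_ne_zero _ hy.ne')
  exact (h1.fun_add h2).fun_sub (h3.const_mul 2)


/-- The twisted first derivative `ψ(y) = y^{1−n}·ρ′(y)`: for `y > 0`, `ρ′(y) = y^{n−1}·ψ(y)`. [folklore] -/
theorem rho'_eq_pow_mul_psi (A B C₀ T₁ : ℝ) {a n : ℕ} (ha : 0 < a) (hn : 0 < n) {y : ℝ} (hy : 0 < y)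
    (hQ : 0 < A * y ^ (2 * n) + B * y ^ n + C₀) :
    T₁ * ((n : ℕ) * y ^ (n - 1))
        + (A * ((2 * n : ℕ) * y ^ (2 * n - 1)) + B * ((n : ℕ) * y ^ (n - 1)))
            / (2 * Real.sqrt (A * y ^ (2 * n) + B * y ^ n + C₀))
        - 2 * (-((a : ℕ) * y ^ (a - 1)) / (y ^ a) ^ 2)
      = y ^ (n - 1) * (T₁ * n + n * (2 * A * y ^ n + B) / (2 * Real.sqrt (A * y ^ (2 * n) + B * y ^ n + C₀))
          + 2 * a * (y ^ (a + n))⁻¹) := by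
  obtain ⟨a', rfl⟩ : ∃ a', a = a' + 1 := ⟨a - 1, by omega⟩
  obtain ⟨n', rfl⟩ : ∃ n', n = n' + 1 := ⟨n - 1, by omega⟩
  have hs : Real.sqrt (A * y ^ (2 * (n' + 1)) + B * y ^ (n' + 1) + C₀) ≠ 0 := (Real.sqrt_pos.mpr hQ).ne'
  have hy0 : y ≠ 0 := hy.ne'
  have e1 : 2 * (n' + 1) - 1 = 2 * n' + 1 := by omega
  simp only [Nat.add_sub_cancel, e1]
  push_cast
  field_simp
  ring

/-- Derivative of the twisted first derivative `ψ`. [folklore] -/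
theorem hasDerivAt_psi (A B C₀ T₁ : ℝ) {a n : ℕ} (ha : 0 < a) (hn : 0 < n) {y : ℝ} (hy : 0 < y)
    (hQ : 0 < A * y ^ (2 * n) + B * y ^ n + C₀) :
    HasDerivAt (fun x : ℝ => T₁ * n + n * (2 * A * x ^ n + B) / (2 * Real.sqrt (A * x ^ (2 * n) + B * x ^ n + C₀))
          + 2 * a * (x ^ (a + n))⁻¹)
      (-((n : ℝ) ^ 2 * (B ^ 2 - 4 * A * C₀) / 4) * y ^ (n - 1)
          / ((A * y ^ (2 * n) + B * y ^ n + C₀) * Real.sqrt (A * y ^ (2 * n) + B * y ^ n + C₀))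
        - 2 * a * (a + n) * (y ^ (a + n + 1))⁻¹) y := by
  have hs0 : 0 < Real.sqrt (A * y ^ (2 * n) + B * y ^ n + C₀) := Real.sqrt_pos.mpr hQ
  have hu : HasDerivAt (fun x : ℝ => (n : ℝ) * (2 * A * x ^ n + B)) ((n : ℝ) * (2 * A * ((n : ℕ) * y ^ (n - 1)))) y := by
    have := ((hasDerivAt_pow n y).const_mul (2 * A)).add_const B
    exact this.const_mul (n : ℝ)
  have hv : HasDerivAt (fun x : ℝ => 2 * Real.sqrt (A * x ^ (2 * n) + B * x ^ n + C₀))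
      (2 * ((A * ((2 * n : ℕ) * y ^ (2 * n - 1)) + B * ((n : ℕ) * y ^ (n - 1)))
        / (2 * Real.sqrt (A * y ^ (2 * n) + B * y ^ n + C₀)))) y :=
    ((hasDerivAt_Q A B C₀ n y).sqrt hQ.ne').const_mul 2
  have huv := hu.fun_div hv (mul_ne_zero two_ne_zero hs0.ne')
  have hw : HasDerivAt (fun x : ℝ => 2 * (a : ℝ) * (x ^ (a + n))⁻¹)
      (2 * (a : ℝ) * (-(((a + n : ℕ) : ℝ) * y ^ (a + n - 1)) / (y ^ (a + n)) ^ 2)) y :=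
    ((hasDerivAt_pow (a + n) y).fun_inv (pow_ne_zero _ hy.ne')).const_mul (2 * (a : ℝ))
  have hall := (huv.const_add (T₁ * n)).fun_add hw
  refine hall.congr_deriv ?_
  -- closed form of the derivative: write `√Q = s`, eliminate `C₀ = s² − A y^{2n} − B yⁿ`
  obtain ⟨a', rfl⟩ : ∃ a', a = a' + 1 := ⟨a - 1, by omega⟩
  obtain ⟨n', rfl⟩ : ∃ n', n = n' + 1 := ⟨n - 1, by omega⟩
  obtain ⟨s, hspos, hs2⟩ : ∃ s : ℝ, 0 < s ∧ s ^ 2 = A * y ^ (2 * (n' + 1)) + B * y ^ (n' + 1) + C₀ :=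
    ⟨_, hs0, Real.sq_sqrt hQ.le⟩
  have hsq : Real.sqrt (A * y ^ (2 * (n' + 1)) + B * y ^ (n' + 1) + C₀) = s := by
    rw [← hs2, Real.sqrt_sq hspos.le]
  have hC : C₀ = s ^ 2 - A * y ^ (2 * (n' + 1)) - B * y ^ (n' + 1) := by linarith
  rw [hsq, hC]
  have e1 : 2 * (n' + 1) - 1 = 2 * n' + 1 := by omega
  have e2 : a' + 1 + (n' + 1) - 1 = a' + n' + 1 := by omega
  simp only [Nat.add_sub_cancel, e1, e2]
  have hy0 : y ≠ 0 := hy.ne'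
  have hsne : s ≠ 0 := hspos.ne'
  push_cast
  field_simp
  ring

/-! ## 2. The critical equation of the second twist and its root count -/

/-- A zero `z > 0` of `ψ′` satisfies the polynomial CRITICAL EQUATION `n⁴Δ²·z^{2a+4n} = 64a²(a+n)²·Q(z)³`
(clear denominators and square). [folklore] -/
theorem critical_eq_of_psi'_eq_zero (A B C₀ : ℝ) {a n : ℕ} {z : ℝ} (hz : 0 < z)
    (hQ : 0 < A * z ^ (2 * n) + B * z ^ n + C₀)
    (h : -((n : ℝ) ^ 2 * (B ^ 2 - 4 * A * C₀) / 4) * z ^ (n - 1)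
          / ((A * z ^ (2 * n) + B * z ^ n + C₀) * Real.sqrt (A * z ^ (2 * n) + B * z ^ n + C₀))
        - 2 * a * (a + n) * (z ^ (a + n + 1))⁻¹ = 0) (hn : 0 < n) :
    (n : ℝ) ^ 4 * (B ^ 2 - 4 * A * C₀) ^ 2 * z ^ (2 * a + 4 * n)
      = 64 * (a : ℝ) ^ 2 * ((a : ℝ) + n) ^ 2 * (A * z ^ (2 * n) + B * z ^ n + C₀) ^ 3 := by
  obtain ⟨n', rfl⟩ : ∃ n', n = n' + 1 := ⟨n - 1, by omega⟩
  obtain ⟨s, hspos, hs2⟩ : ∃ s : ℝ, 0 < s ∧ s ^ 2 = A * z ^ (2 * (n' + 1)) + B * z ^ (n' + 1) + C₀ :=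
    ⟨_, Real.sqrt_pos.mpr hQ, Real.sq_sqrt hQ.le⟩
  have hsq : Real.sqrt (A * z ^ (2 * (n' + 1)) + B * z ^ (n' + 1) + C₀) = s := by
    rw [← hs2, Real.sqrt_sq hspos.le]
  rw [hsq, ← hs2] at h
  rw [← hs2]
  have hz0 : z ≠ 0 := hz.ne'
  have hsne : s ≠ 0 := hspos.ne'
  simp only [Nat.add_sub_cancel] at h
  -- from `h`: (n'+1)² Δ z^{a+2n} = −8a(a+n) s³ (after clearing denominators), then square
  have h1 : ((n' : ℝ) + 1) ^ 2 * (B ^ 2 - 4 * A * C₀) * z ^ (a + 2 * (n' + 1))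
      = -(8 * (a : ℝ) * ((a : ℝ) + (n' + 1 : ℕ)) * s ^ 3) := by
    field_simp at h
    have e : z ^ (a + 2 * (n' + 1)) = z ^ n' * z ^ (a + (n' + 1) + 1) := by rw [← pow_add]; congr 1; ring
    rw [e]
    push_cast at h ⊢
    linear_combination -h
  have h2 : (((n' : ℝ) + 1) ^ 2 * (B ^ 2 - 4 * A * C₀) * z ^ (a + 2 * (n' + 1))) ^ 2
      = (-(8 * (a : ℝ) * ((a : ℝ) + (n' + 1 : ℕ)) * s ^ 3)) ^ 2 := by rw [h1]
  have e2 : z ^ (2 * a + 4 * (n' + 1)) = (z ^ (a + 2 * (n' + 1))) ^ 2 := by rw [← pow_mul]; congr 1; ring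
  rw [e2]
  push_cast at h2 ⊢
  linear_combination ((n' : ℝ) + 1) ^ 0 * h2

/-- The Descartes step: the fewnomial `A·w^{6n} − κ·w^{2a+4n} + B·w^{3n} + C₀` (`0 < a < n`, `A, κ, C₀ ≥ 0`, any `B`) has at most
TWO distinct positive roots (`0 < a`, `0 < m`, `A, C₀ ≥ 0`, ANY `κ, B`) — one Euler twist at the exponent `3n` (`Census.card_posRoots_le_card_posRoots_twists`) leaves the
trinomial `−3n·C₀ − κ(2a+n)·w^{2a+4n} + 3n·A·w^{6n}` with signs `(≤0, ·, ≥0)`, which has at most one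
(`SquareLaw.card_posRoots_le_one_of_nonpos_nonneg'`). [folklore] -/
theorem card_posRoots_criticalFewnomial_le_two (A B C₀ κ : ℝ) {a m : ℕ} (ha : 0 < a) (hm : 0 < m)
    (hA : 0 ≤ A) (hC : 0 ≤ C₀) :
    ((∑ t : Fin 4, C ((![A, -κ, B, C₀] : Fin 4 → ℝ) t)
        * X ^ ((![6 * (a + m), 2 * a + 4 * (a + m), 3 * (a + m), 0] : Fin 4 → ℕ) t)).roots.toFinset.filter
        (fun x => 0 < x)).card ≤ 2 := by
  have htw := Census.card_posRoots_le_card_posRoots_twists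
    (![6 * (a + m), 2 * a + 4 * (a + m), 3 * (a + m), 0] : Fin 4 → ℕ) (![A, -κ, B, C₀] : Fin 4 → ℝ) {2}
  rw [Finset.card_singleton] at htw
  -- the twisted fewnomial is a trinomial with signs (≤ 0, ·, ≥ 0)
  have hone := SquareLaw.card_posRoots_le_one_of_nonpos_nonneg' 0 (2 * a + 4 * (a + m)) (2 * m) (by omega) (by omega)
    (C₀ * (((0 : ℕ) : ℝ) - ((3 * (a + m) : ℕ) : ℝ))) (-κ * (((2 * a + 4 * (a + m) : ℕ) : ℝ) - ((3 * (a + m) : ℕ) : ℝ)))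
    (A * (((6 * (a + m) : ℕ) : ℝ) - ((3 * (a + m) : ℕ) : ℝ)))
    (mul_nonpos_of_nonneg_of_nonpos hC (by push_cast; nlinarith))
    (mul_nonneg hA (by push_cast; nlinarith))
  have hsum : (∑ t : Fin 4, C ((![A, -κ, B, C₀] : Fin 4 → ℝ) t * ∏ u ∈ ({2} : Finset (Fin 4)),
        ((((![6 * (a + m), 2 * a + 4 * (a + m), 3 * (a + m), 0] : Fin 4 → ℕ) t : ℕ) : ℝ)
          - (((![6 * (a + m), 2 * a + 4 * (a + m), 3 * (a + m), 0] : Fin 4 → ℕ) u : ℕ) : ℝ)))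
        * X ^ ((![6 * (a + m), 2 * a + 4 * (a + m), 3 * (a + m), 0] : Fin 4 → ℕ) t))
      = C (C₀ * (((0 : ℕ) : ℝ) - ((3 * (a + m) : ℕ) : ℝ))) * X ^ 0
        + C (-κ * (((2 * a + 4 * (a + m) : ℕ) : ℝ) - ((3 * (a + m) : ℕ) : ℝ))) * X ^ (0 + (2 * a + 4 * (a + m)))
        + C (A * (((6 * (a + m) : ℕ) : ℝ) - ((3 * (a + m) : ℕ) : ℝ))) * X ^ (0 + (2 * a + 4 * (a + m)) + 2 * m) := by
    simp only [Fin.sum_univ_four, Finset.prod_singleton, Matrix.cons_val_zero, Matrix.cons_val_one,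
      Matrix.cons_val_two, Matrix.cons_val, Matrix.vecHead, Matrix.vecTail, Function.comp_apply, Fin.succ_zero_eq_one]
    have e3 : 0 + (2 * a + 4 * (a + m)) + 2 * m = 6 * (a + m) := by ring
    rw [e3, zero_add, sub_self, mul_zero, map_zero, zero_mul, add_zero]
    ring
  rw [hsum] at htw
  exact htw.trans (Nat.succ_le_succ hone)

/-- **Three critical points are impossible.**  If `0 < a < n`, `A, C₀ ≥ 0`, `B² ≤ 4AC₀` and `Q(z₀) > 0`, then the critical equation
`n⁴Δ²·z^{2a+4n} = 64a²(a+n)²·Q(z)³` has at most two positive solutions: along `z = w³` it reads `Q = κ·w^{2a+4n}` with `κ ≥ 0` the real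
cube root of `n⁴Δ²/(64a²(a+n)²)`, i.e. `w` is a positive root of the fewnomial of `card_posRoots_criticalFewnomial_le_two`. [folklore] -/
theorem critical_eq_three_false (A B C₀ : ℝ) {a n : ℕ} (ha : 0 < a) (han : a < n) (hA : 0 ≤ A) (hC : 0 ≤ C₀)
    (hΔ : B ^ 2 ≤ 4 * A * C₀) {z : Fin 3 → ℝ} (hz0 : 0 < z 0) (hz : StrictMono z)
    (hQ : 0 < A * z 0 ^ (2 * n) + B * z 0 ^ n + C₀)
    (hcrit : ∀ j, (n : ℝ) ^ 4 * (B ^ 2 - 4 * A * C₀) ^ 2 * z j ^ (2 * a + 4 * n)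
      = 64 * (a : ℝ) ^ 2 * ((a : ℝ) + n) ^ 2 * (A * z j ^ (2 * n) + B * z j ^ n + C₀) ^ 3) : False := by
  obtain ⟨m, hm, rfl⟩ : ∃ m, 0 < m ∧ n = a + m := ⟨n - a, by omega, by omega⟩
  have hzpos : ∀ j, 0 < z j := fun j => lt_of_lt_of_le hz0 (hz.monotone (Fin.zero_le j))
  have hden : 0 < 64 * (a : ℝ) ^ 2 * ((a : ℝ) + (a + m : ℕ)) ^ 2 := by positivity
  set κ₀ : ℝ := ((a + m : ℕ) : ℝ) ^ 4 * (B ^ 2 - 4 * A * C₀) ^ 2 / (64 * (a : ℝ) ^ 2 * ((a : ℝ) + (a + m : ℕ)) ^ 2) with hκ₀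
  have hκ₀nn : 0 ≤ κ₀ := by positivity
  -- cube roots
  set w : Fin 3 → ℝ := fun j => (z j) ^ ((((3 : ℕ) : ℝ))⁻¹) with hw
  have hw3 : ∀ j, w j ^ 3 = z j := fun j => Real.rpow_inv_natCast_pow (hzpos j).le (by norm_num)
  have hwpos : ∀ j, 0 < w j := fun j => Real.rpow_pos_of_pos (hzpos j) _
  have hwmono : StrictMono w := fun i j hij =>
    Real.rpow_lt_rpow (hzpos i).le (hz hij) (by positivity)
  set κ : ℝ := κ₀ ^ ((((3 : ℕ) : ℝ))⁻¹) with hκ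
  have hκ3 : κ ^ 3 = κ₀ := Real.rpow_inv_natCast_pow hκ₀nn (by norm_num)
  -- along z = w³ the critical equation says: Q(z) = κ · w^{2a+4n}
  have hroot : ∀ j, A * w j ^ (6 * (a + m)) + B * w j ^ (3 * (a + m)) + C₀ = κ * w j ^ (2 * a + 4 * (a + m)) := by
    intro j
    have hQw : A * z j ^ (2 * (a + m)) + B * z j ^ (a + m) + C₀ = A * w j ^ (6 * (a + m)) + B * w j ^ (3 * (a + m)) + C₀ := by
      rw [← hw3 j, ← pow_mul, ← pow_mul]
      congr 3; ring
    have hwe : (w j ^ (2 * a + 4 * (a + m))) ^ 3 = z j ^ (2 * a + 4 * (a + m)) := by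
      rw [← pow_mul, mul_comm, pow_mul, hw3 j]
    have hcube : (A * w j ^ (6 * (a + m)) + B * w j ^ (3 * (a + m)) + C₀) ^ 3 = (κ * w j ^ (2 * a + 4 * (a + m))) ^ 3 := by
      rw [mul_pow, hκ3, ← hQw, hwe, hκ₀, div_mul_eq_mul_div, eq_div_iff hden.ne', hcrit j]
      ring
    exact (Odd.strictMono_pow (by decide : Odd 3)).injective hcube
  -- the fewnomial with roots w 0 < w 1 < w 2
  set P : ℝ[X] := ∑ t : Fin 4, C ((![A, -κ, B, C₀] : Fin 4 → ℝ) t)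
      * X ^ ((![6 * (a + m), 2 * a + 4 * (a + m), 3 * (a + m), 0] : Fin 4 → ℕ) t) with hP
  have hPeval : ∀ j, P.eval (w j) = 0 := by
    intro j
    rw [hP, eval_finsetSum]
    simp only [Fin.sum_univ_four, eval_mul, eval_C, eval_pow, eval_X, Matrix.cons_val_zero, Matrix.cons_val_one,
      Matrix.cons_val_two, Matrix.cons_val, Matrix.vecHead, Matrix.vecTail, Function.comp_apply, Fin.succ_zero_eq_one,
      pow_zero, mul_one]
    linear_combination hroot j
  have hP0 : P ≠ 0 := by
    intro h0
    have hc0 : P.coeff 0 = C₀ := by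
      rw [hP, finsetSum_coeff]
      simp only [Fin.sum_univ_four, coeff_C_mul, coeff_X_pow, Matrix.cons_val_zero, Matrix.cons_val_one,
        Matrix.cons_val_two, Matrix.cons_val, Matrix.vecHead, Matrix.vecTail, Function.comp_apply, Fin.succ_zero_eq_one]
      have h1 : (0 : ℕ) ≠ 6 * (a + m) := by omega
      have h2 : (0 : ℕ) ≠ 2 * a + 4 * (a + m) := by omega
      have h3 : (0 : ℕ) ≠ 3 * (a + m) := by omega
      simp [h1, h2, h3]
    have hc6 : P.coeff (6 * (a + m)) = A := by
      rw [hP, finsetSum_coeff]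
      simp only [Fin.sum_univ_four, coeff_C_mul, coeff_X_pow, Matrix.cons_val_zero, Matrix.cons_val_one,
        Matrix.cons_val_two, Matrix.cons_val, Matrix.vecHead, Matrix.vecTail, Function.comp_apply, Fin.succ_zero_eq_one]
      have h2 : 6 * (a + m) ≠ 2 * a + 4 * (a + m) := by omega
      have h3 : 6 * (a + m) ≠ 3 * (a + m) := by omega
      have h4 : 6 * (a + m) ≠ 0 := by omega
      simp [h2, h3, h4]
    rw [h0, coeff_zero] at hc0 hc6
    have hB : B = 0 := by
      have : B ^ 2 ≤ 0 := by rw [← hc0, ← hc6] at hΔ; simpa using hΔ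
      exact pow_eq_zero_iff two_ne_zero |>.mp (le_antisymm this (sq_nonneg B))
    rw [← hc0, ← hc6, hB] at hQ
    simp at hQ
  -- three distinct positive roots versus at most two
  have hmem : ∀ j, w j ∈ P.roots.toFinset.filter (fun x => 0 < x) := fun j => by
    simp only [Finset.mem_filter, Multiset.mem_toFinset]
    exact ⟨(mem_roots hP0).mpr (hPeval j), hwpos j⟩
  have h01 : w 0 ≠ w 1 := (hwmono (by decide : (0 : Fin 3) < 1)).ne
  have h02 : w 0 ≠ w 2 := (hwmono (by decide : (0 : Fin 3) < 2)).ne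
  have h12 : w 1 ≠ w 2 := (hwmono (by decide : (1 : Fin 3) < 2)).ne
  have hsub : ({w 0, w 1, w 2} : Finset ℝ) ⊆ P.roots.toFinset.filter (fun x => 0 < x) := by
    intro x hx
    simp only [Finset.mem_insert, Finset.mem_singleton] at hx
    rcases hx with rfl | rfl | rfl <;> exact hmem _
  have hcard : ({w 0, w 1, w 2} : Finset ℝ).card = 3 := by
    rw [Finset.card_insert_of_notMem (by simp [h01, h02]), Finset.card_insert_of_notMem (by simp [h12]),
      Finset.card_singleton]
  have h3 := (Finset.card_le_card hsub)
  rw [hcard] at h3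
  have h2 := card_posRoots_criticalFewnomial_le_two A B C₀ κ ha hm hA hC
  rw [← hP] at h2
  omega

/-! ## 3. Rolle twice: the defect `ρ` has at most four positive zeros -/

/-- **THE TOP-BRANCH DEFECT HAS AT MOST FOUR ZEROS.**  Let `0 < a < n`, `A, C₀ ≥ 0`, `B² ≤ 4AC₀`, and `Q(x) = A x^{2n} + B xⁿ + C₀ > 0` for all
`x > 0`.  Then `ρ(x) = T₀ + T₁xⁿ + √Q(x) − 2/xᵃ` does not vanish at five points `0 < x₀ < x₁ < x₂ < x₃ < x₄`.  PROOF: Rolle gives four zeros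
of `ρ′ = x^{n−1}ψ` (`hasDerivAt_rho`, `rho'_eq_pow_mul_psi`), Rolle again three zeros of `ψ′` (`hasDerivAt_psi`), each a solution of the critical
equation (`critical_eq_of_psi'_eq_zero`), and three solutions are impossible (`critical_eq_three_false`). [folklore] -/
theorem rho_five_zeros_false (A B C₀ T₀ T₁ : ℝ) {a n : ℕ} (ha : 0 < a) (han : a < n) (hA : 0 ≤ A) (hC : 0 ≤ C₀)
    (hΔ : B ^ 2 ≤ 4 * A * C₀) (hQ : ∀ x : ℝ, 0 < x → 0 < A * x ^ (2 * n) + B * x ^ n + C₀)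
    {x : Fin 5 → ℝ} (hx0 : 0 < x 0) (hx : StrictMono x)
    (hroot : ∀ i, T₀ + T₁ * x i ^ n + Real.sqrt (A * x i ^ (2 * n) + B * x i ^ n + C₀) - 2 * (x i ^ a)⁻¹ = 0) : False := by
  have hn : 0 < n := lt_of_le_of_lt (Nat.zero_le a) han
  have hxpos : ∀ i, 0 < x i := fun i => lt_of_lt_of_le hx0 (hx.monotone (Fin.zero_le i))
  -- Rolle 1
  have hR1 : ∀ i : Fin 4, ∃ y, x i.castSucc < y ∧ y < x i.succ ∧
      T₁ * ((n : ℕ) * y ^ (n - 1))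
        + (A * ((2 * n : ℕ) * y ^ (2 * n - 1)) + B * ((n : ℕ) * y ^ (n - 1)))
            / (2 * Real.sqrt (A * y ^ (2 * n) + B * y ^ n + C₀))
        - 2 * (-((a : ℕ) * y ^ (a - 1)) / (y ^ a) ^ 2) = 0 := by
    intro i
    have hlt : x i.castSucc < x i.succ := hx (Fin.castSucc_lt_succ (i := i))
    have hpos : ∀ y ∈ Icc (x i.castSucc) (x i.succ), 0 < y := fun y hy => lt_of_lt_of_le (hxpos _) hy.1
    obtain ⟨c, hc, hc0⟩ := exists_hasDerivAt_eq_zero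
      (f := fun t : ℝ => T₀ + T₁ * t ^ n + Real.sqrt (A * t ^ (2 * n) + B * t ^ n + C₀) - 2 * (t ^ a)⁻¹) hlt
      (fun y hy => (hasDerivAt_rho A B C₀ T₀ T₁ a n (hpos y hy) (hQ y (hpos y hy))).continuousAt.continuousWithinAt)
      (by rw [hroot, hroot])
      (fun y hy => hasDerivAt_rho A B C₀ T₀ T₁ a n (hpos y (Ioo_subset_Icc_self hy)) (hQ y (hpos y (Ioo_subset_Icc_self hy))))
    exact ⟨c, hc.1, hc.2, hc0⟩
  choose y hy1 hy2 hy0 using hR1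
  have hypos : ∀ i, 0 < y i := fun i => (hxpos _).trans (hy1 i)
  have hymono : StrictMono y := by
    refine Fin.strictMono_iff_lt_succ.mpr fun i => ?_
    calc y i.castSucc < x i.castSucc.succ := hy2 _
      _ = x i.succ.castSucc := by rw [Fin.succ_castSucc]
      _ < y i.succ := hy1 _
  -- zeros of ψ
  have hpsi : ∀ i, T₁ * n + n * (2 * A * y i ^ n + B) / (2 * Real.sqrt (A * y i ^ (2 * n) + B * y i ^ n + C₀))
      + 2 * a * (y i ^ (a + n))⁻¹ = 0 := by
    intro i
    have h := hy0 i
    rw [rho'_eq_pow_mul_psi A B C₀ T₁ ha hn (hypos i) (hQ _ (hypos i))] at h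
    rcases mul_eq_zero.mp h with h' | h'
    · exact absurd h' (pow_ne_zero _ (hypos i).ne')
    · exact h'
  -- Rolle 2
  have hR2 : ∀ j : Fin 3, ∃ z, y j.castSucc < z ∧ z < y j.succ ∧
      -((n : ℝ) ^ 2 * (B ^ 2 - 4 * A * C₀) / 4) * z ^ (n - 1)
          / ((A * z ^ (2 * n) + B * z ^ n + C₀) * Real.sqrt (A * z ^ (2 * n) + B * z ^ n + C₀))
        - 2 * a * (a + n) * (z ^ (a + n + 1))⁻¹ = 0 := by
    intro j
    have hlt : y j.castSucc < y j.succ := hymono (Fin.castSucc_lt_succ (i := j))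
    have hpos : ∀ t ∈ Icc (y j.castSucc) (y j.succ), 0 < t := fun t ht => lt_of_lt_of_le (hypos _) ht.1
    obtain ⟨c, hc, hc0⟩ := exists_hasDerivAt_eq_zero
      (f := fun t : ℝ => T₁ * n + n * (2 * A * t ^ n + B) / (2 * Real.sqrt (A * t ^ (2 * n) + B * t ^ n + C₀))
          + 2 * a * (t ^ (a + n))⁻¹) hlt
      (fun t ht => (hasDerivAt_psi A B C₀ T₁ ha hn (hpos t ht) (hQ t (hpos t ht))).continuousAt.continuousWithinAt)
      (by rw [hpsi, hpsi])
      (fun t ht => hasDerivAt_psi A B C₀ T₁ ha hn (hpos t (Ioo_subset_Icc_self ht)) (hQ t (hpos t (Ioo_subset_Icc_self ht))))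
    exact ⟨c, hc.1, hc.2, hc0⟩
  choose z hz1 hz2 hz0 using hR2
  have hzpos : ∀ j, 0 < z j := fun j => (hypos _).trans (hz1 j)
  have hzmono : StrictMono z := by
    refine Fin.strictMono_iff_lt_succ.mpr fun j => ?_
    calc z j.castSucc < y j.castSucc.succ := hz2 _
      _ = y j.succ.castSucc := by rw [Fin.succ_castSucc]
      _ < z j.succ := hz1 _
  -- the critical equation at three points
  have hcrit : ∀ j, (n : ℝ) ^ 4 * (B ^ 2 - 4 * A * C₀) ^ 2 * z j ^ (2 * a + 4 * n)
      = 64 * (a : ℝ) ^ 2 * ((a : ℝ) + n) ^ 2 * (A * z j ^ (2 * n) + B * z j ^ n + C₀) ^ 3 :=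
    fun j => critical_eq_of_psi'_eq_zero A B C₀ (hzpos j) (hQ _ (hzpos j)) (hz0 j) hn
  exact critical_eq_three_false A B C₀ ha han hA hC hΔ (hzpos 0) hzmono (hQ _ (hzpos 0)) hcrit

end EndLetterTwo

end Summit.ValiantsHypothesis.ValiantsHypothesis.Theorems.LacunarySymmetroidMatrixDescartes.Census
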